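import Summits.AtomisticToContinuum.Crystallization.Theorems.FrustratedLawDichotomyCollarCensus

/-!
# FrustratedLawDichotomy · crux `AperiodicFrustratedLawGap` (stmt-AtomisticToContinuum-27623) — NON-EXEMPTION CERTIFICATES for the
# collared exemption of record `CollarCore r eUp ε Rm s t = Collar r (MoveUnstableCore ε Rm s ∨ RemovalUnstableCore eUp t Rm)`
# (decomp-a2c, prover hand 2, generation 16; critic rows 577 (5)(c) / 578 (B)(1))

The X-kernels (`…PeriodicBlockFlagsX`, `…ExemptLocOptLocal`) and every motif-level piece of the collared T-side leaf line
(`…CollarCensus.aperiodicFrustratedLawGap_of_collarPieces_record`) consume NON-EXEMPTION literals `¬ Ex N y j`.  For the exemption of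
record this file reduces `¬ CollarCore …` at a site to FINITELY MANY CLOSED-FORM REAL INEQUALITIES on the atoms within `Rm` — no
branch-and-bound over the continuum of one-atom moves:

* §1 bookkeeping: `¬ Collar r P ⟺ ∀ k ∈ ball r, ¬ P k`; `¬ NonEquilibriumCore ⟺ ¬ Move ∧ ¬ Removal`; the removal test is ONE inequality
  (`not_removalUnstableCore_iff`).
* §2 ★ `not_moveUnstableCore_of_bregmanCert` — THE MOVE TEST IN THE SQUARED-DISTANCE VARIABLE.  With `w_k = y_j − y_k`, `Q_k = ‖w_k‖²`,
  `Ṽ(P) = P⁻⁶/12 − P⁻³/6` (`V_LJ(r) = Ṽ(r²)`, cf. `Literature…LennardJonesSquaredDistance`), `Ṽ'(Q) = −Q⁻⁷/2 + Q⁻⁴/2`, a move `p = y_j + d`, `‖d‖ ≤ s`, changes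
  bond `k` to `P_k = Q_k + 2⟪w_k, d⟫ + ‖d‖²` EXACTLY; given per-bond BREGMAN CONSTANTS `c_k` (`Ṽ(P) − Ṽ(Q_k) − Ṽ'(Q_k)(P − Q_k) ≥ c_k (P − Q_k)²`
  on the range of `P_k`), summing gives the closed form
  `Σ_k [Ṽ(P_k) − Ṽ(Q_k)] ≥ ⟪F, d⟫ + (Σ_k Ṽ'(Q_k)) ‖d‖² + 4 Σ_k c_k ⟪w_k, d⟫² + 4 ‖d‖² ⟪Σ_k c_k w_k, d⟫ + ‖d‖⁴ Σ_k c_k`, `F = Σ_k 2 Ṽ'(Q_k) w_k`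
  (the NET FORCE enters summed — the cancellation a bond-by-bond bound cannot see), hence `≥ −φ_F ρ + λ ρ² − β ρ³ + C₄ ρ⁴` (`ρ = ‖d‖`) from a force
  bound `φ_F`, a quadratic-form bound `λ`, `β ≥ ‖4 Σ c_k w_k‖`, `C₄ ≤ Σ c_k`; if this quartic stays `≥ −(ε + slack)` on `[0, s]` the site passes
  the move test.  `…_of_bregmanCert_closed`: the sufficient scalar condition `λ − β s + C₄⁻ s² =: L > 0 ∧ φ_F² ≤ 4 L (ε + slack)`.
* §3 the range bookkeeping `sq_dist_mem_range` (`P_k ∈ [(r_lo − s)², (r_hi + s)²]` from enclosures `r_lo ≤ ‖w_k‖ ≤ r_hi`, `s ≤ r_lo`) and the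
  assembled site certificate `not_collarCore_of_certs`.

For a rational periodic cell every datum above (`Q_k`, `w_k`, `Ṽ'(Q_k)`, `F`, the matrix `Σ c_k w_k w_kᵀ`) is exactly rational, so a checker in
the style of `…CellChecker` discharges the hypotheses by `decide`; the Bregman constants come from a menu of one-variable lemmas
(`Literature…LennardJonesSquaredDistance.lennardJonesSq_bregman_ge` gives `c = 1/8` on `(0, 10/9]`; sharper menu entries are separate files).  All `[folklore]`; 0 sorry.
-/

noncomputable section

namespace Summit.AtomisticToContinuum.Crystallization.Theorems.FrustratedLawDichotomyCollarNonExempt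

open scoped BigOperators Classical RealInnerProductSpace
open Literature.MathematicalPhysics.StatisticalMechanics (lennardJones)
open Summit.AtomisticToContinuum.Crystallization.Theorems.FrustratedLawDichotomyAveragingCut (ball mem_ball)
open Summit.AtomisticToContinuum.Crystallization.Theorems.FrustratedLawDichotomyExemptDoor (SitePred)
open Summit.AtomisticToContinuum.Crystallization.Theorems.FrustratedLawDichotomyExemptLocalSharp (tailConstSharp)
open Summit.AtomisticToContinuum.Crystallization.Theorems.FrustratedLawDichotomyExemptAbsorptionRecord
  (MoveUnstableCore RemovalUnstableCore NonEquilibriumCore)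
open Summit.AtomisticToContinuum.Crystallization.Theorems.FrustratedLawDichotomyCollarCensus (Collar CollarCore)

/-! ## §1. Bookkeeping: collar, disjunction, removal -/

/-- `¬ Collar r P` at `j` iff NO site of the `r`-ball about `j` carries `P`. [folklore] -/
theorem not_collar_iff {r : ℝ} {P : SitePred} {N : ℕ} {y : Fin N → EuclideanSpace ℝ (Fin 3)} {j : Fin N} :
    ¬ Collar r P N y j ↔ ∀ k ∈ ball r y j, ¬ P N y k := by
  unfold Collar
  simp only [not_exists, not_and]

/-- `¬ NonEquilibriumCore` iff the site passes BOTH the move test and the removal test. [folklore] -/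
theorem not_nonEquilibriumCore_iff {eUp ε Rm s t : ℝ} {N : ℕ} {y : Fin N → EuclideanSpace ℝ (Fin 3)} {j : Fin N} :
    ¬ NonEquilibriumCore eUp ε Rm s t N y j ↔ ¬ MoveUnstableCore ε Rm s N y j ∧ ¬ RemovalUnstableCore eUp t Rm N y j := by
  unfold NonEquilibriumCore
  exact not_or

/-- The removal test is ONE closed-form inequality: the site passes iff its local binding within `Rm` is `≤ eUp + t + T♯(Rm)`. [folklore] -/
theorem not_removalUnstableCore_iff {eUp t Rm : ℝ} {N : ℕ} {y : Fin N → EuclideanSpace ℝ (Fin 3)} {j : Fin N} :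
    ¬ RemovalUnstableCore eUp t Rm N y j ↔
      (∑ k ∈ (Finset.univ.erase j).filter (fun k => dist (y k) (y j) ≤ Rm), lennardJones (dist (y j) (y k))) ≤
        eUp + t + tailConstSharp Rm := by
  unfold RemovalUnstableCore
  exact not_lt

/-- `¬ CollarCore r eUp ε Rm s t` at `j` from the two tests at every site of the `r`-ball. [folklore] -/
theorem not_collarCore_of_forall {r eUp ε Rm s t : ℝ} {N : ℕ} {y : Fin N → EuclideanSpace ℝ (Fin 3)} {j : Fin N}
    (hmove : ∀ k ∈ ball r y j, ¬ MoveUnstableCore ε Rm s N y k) (hrem : ∀ k ∈ ball r y j, ¬ RemovalUnstableCore eUp t Rm N y k) :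
    ¬ CollarCore r eUp ε Rm s t N y j := by
  unfold CollarCore
  rw [not_collar_iff]
  intro k hk
  exact not_nonEquilibriumCore_iff.2 ⟨hmove k hk, hrem k hk⟩

/-! ## §2. The move test in the squared-distance variable -/

/-- `V_LJ(dist p q) = Ṽ(dist p q ²)` with `Ṽ(P) = P⁻⁶/12 − P⁻³/6`. [folklore] -/
theorem lennardJones_dist_eq_sq (p q : EuclideanSpace ℝ (Fin 3)) :
    lennardJones (dist p q) = (1 / 12) * (dist p q ^ 2)⁻¹ ^ 6 - (1 / 6) * (dist p q ^ 2)⁻¹ ^ 3 := by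
  unfold lennardJones
  ring

/-- The squared length of a moved bond, EXACTLY: `dist (y_j + d) y_k ² = ‖y_j − y_k‖² + 2⟪y_j − y_k, d⟫ + ‖d‖²` (here with `d = p − y_j`).
[folklore] -/
theorem sq_dist_move (p a b : EuclideanSpace ℝ (Fin 3)) :
    dist p b ^ 2 = dist a b ^ 2 + 2 * ⟪a - b, p - a⟫ + ‖p - a‖ ^ 2 := by
  rw [dist_eq_norm, dist_eq_norm, show p - b = (a - b) + (p - a) by abel, norm_add_sq_real]

/-- ★★ **The move test from a Bregman certificate** (`not_moveUnstableCore_of_bregmanCert`).  Site `j`, local set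
`K = {k ≠ j : dist y_k y_j ≤ Rm}`, `w_k = y_j − y_k`, `Q_k = dist y_j y_k ²`, `Ṽ'(Q) = −Q⁻⁷/2 + Q⁻⁴/2`.  HYPOTHESES: a range `[Plo k, Phi k] ∋ dist p y_k ²`
for every move `dist p y_j ≤ s` (`hrange`, see `sq_dist_mem_range`); per-bond Bregman constants `hbreg`; a quadratic-form bound `hA`
(`λ‖v‖² ≤ (Σ Ṽ'(Q_k))‖v‖² + 4 Σ c_k ⟪w_k, v⟫²` for all `v`); norm bounds `hB`, `hF` on `4 Σ c_k w_k` and on the net force `Σ 2Ṽ'(Q_k) w_k`; `C₄ ≤ Σ c_k`;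
and the scalar condition `hfin : −(ε + slack) ≤ −φ_F ρ + λ ρ² − β ρ³ + C₄ ρ⁴` on `[0, s]` (`slack = s (Rm/(Rm−s))⁷ S₇♯(Rm)` as in the definition).
CONCLUSION: the site passes the move test. [folklore] -/
theorem not_moveUnstableCore_of_bregmanCert {ε Rm s : ℝ} {N : ℕ} {y : Fin N → EuclideanSpace ℝ (Fin 3)} {j : Fin N}
    (c Plo Phi : Fin N → ℝ) (lam beta phiF C4 : ℝ)
    (hrange : ∀ k ∈ (Finset.univ.erase j).filter (fun k => dist (y k) (y j) ≤ Rm), ∀ p : EuclideanSpace ℝ (Fin 3),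
      dist p (y j) ≤ s → Plo k ≤ dist p (y k) ^ 2 ∧ dist p (y k) ^ 2 ≤ Phi k)
    (hbreg : ∀ k ∈ (Finset.univ.erase j).filter (fun k => dist (y k) (y j) ≤ Rm), ∀ P : ℝ, Plo k ≤ P → P ≤ Phi k →
      c k * (P - dist (y j) (y k) ^ 2) ^ 2 ≤
        ((1 / 12) * P⁻¹ ^ 6 - (1 / 6) * P⁻¹ ^ 3) - ((1 / 12) * (dist (y j) (y k) ^ 2)⁻¹ ^ 6 - (1 / 6) * (dist (y j) (y k) ^ 2)⁻¹ ^ 3) -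
          (-(1 / 2) * (dist (y j) (y k) ^ 2)⁻¹ ^ 7 + (1 / 2) * (dist (y j) (y k) ^ 2)⁻¹ ^ 4) * (P - dist (y j) (y k) ^ 2))
    (hA : ∀ v : EuclideanSpace ℝ (Fin 3),
      lam * ‖v‖ ^ 2 ≤ (∑ k ∈ (Finset.univ.erase j).filter (fun k => dist (y k) (y j) ≤ Rm),
          (-(1 / 2) * (dist (y j) (y k) ^ 2)⁻¹ ^ 7 + (1 / 2) * (dist (y j) (y k) ^ 2)⁻¹ ^ 4)) * ‖v‖ ^ 2 +
        4 * ∑ k ∈ (Finset.univ.erase j).filter (fun k => dist (y k) (y j) ≤ Rm), c k * ⟪y j - y k, v⟫ ^ 2)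
    (hB : ‖∑ k ∈ (Finset.univ.erase j).filter (fun k => dist (y k) (y j) ≤ Rm), (4 * c k) • (y j - y k)‖ ≤ beta)
    (hF : ‖∑ k ∈ (Finset.univ.erase j).filter (fun k => dist (y k) (y j) ≤ Rm),
      (2 * (-(1 / 2) * (dist (y j) (y k) ^ 2)⁻¹ ^ 7 + (1 / 2) * (dist (y j) (y k) ^ 2)⁻¹ ^ 4)) • (y j - y k)‖ ≤ phiF)
    (hC4 : C4 ≤ ∑ k ∈ (Finset.univ.erase j).filter (fun k => dist (y k) (y j) ≤ Rm), c k)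
    (hfin : ∀ ρ : ℝ, 0 ≤ ρ → ρ ≤ s →
      -(ε + s * (Rm / (Rm - s)) ^ 7 * (6000 / 343 * Rm⁻¹ ^ 4 + 2880 / 49 * Rm⁻¹ ^ 5 + 10 / 7 * Rm⁻¹ ^ 6 + 2 * Rm⁻¹ ^ 7)) ≤
        -phiF * ρ + lam * ρ ^ 2 - beta * ρ ^ 3 + C4 * ρ ^ 4) :
    ¬ MoveUnstableCore ε Rm s N y j := by
  unfold MoveUnstableCore
  rintro ⟨p, hps, -, hlt⟩
  set K := (Finset.univ.erase j).filter (fun k => dist (y k) (y j) ≤ Rm) with hK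
  set d : EuclideanSpace ℝ (Fin 3) := p - y j with hd
  have hρ : ‖d‖ = dist p (y j) := by rw [hd, ← dist_eq_norm]
  have hρ0 : 0 ≤ ‖d‖ := norm_nonneg _
  have hρs : ‖d‖ ≤ s := hρ ▸ hps
  -- abbreviations for the per-bond data
  set Q : Fin N → ℝ := fun k => dist (y j) (y k) ^ 2 with hQ
  set dV : Fin N → ℝ := fun k => -(1 / 2) * (Q k)⁻¹ ^ 7 + (1 / 2) * (Q k)⁻¹ ^ 4 with hdV
  set Pk : Fin N → ℝ := fun k => dist p (y k) ^ 2 with hPk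
  have hP : ∀ k, Pk k = Q k + 2 * ⟪y j - y k, d⟫ + ‖d‖ ^ 2 := fun k => by
    simp only [hPk, hQ, hd]; exact sq_dist_move p (y j) (y k)
  -- the per-bond inequality
  have hbond : ∀ k ∈ K, dV k * (2 * ⟪y j - y k, d⟫ + ‖d‖ ^ 2) + c k * (2 * ⟪y j - y k, d⟫ + ‖d‖ ^ 2) ^ 2 ≤
      lennardJones (dist p (y k)) - lennardJones (dist (y j) (y k)) := by
    intro k hk
    have hr := hrange k hk p hps
    have hb := hbreg k hk (Pk k) hr.1 hr.2
    rw [lennardJones_dist_eq_sq, lennardJones_dist_eq_sq]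
    have e : Pk k - Q k = 2 * ⟪y j - y k, d⟫ + ‖d‖ ^ 2 := by rw [hP k]; ring
    rw [← e]
    simp only [hPk, hQ, hdV] at hb ⊢
    linarith
  have hsum := Finset.sum_le_sum hbond
  rw [Finset.sum_add_distrib, Finset.sum_sub_distrib] at hsum
  -- expand the left-hand side
  have hlin : ∑ k ∈ K, dV k * (2 * ⟪y j - y k, d⟫ + ‖d‖ ^ 2) =
      ⟪∑ k ∈ K, (2 * dV k) • (y j - y k), d⟫ + (∑ k ∈ K, dV k) * ‖d‖ ^ 2 := by
    rw [sum_inner, Finset.sum_mul, ← Finset.sum_add_distrib]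
    refine Finset.sum_congr rfl fun k _ => ?_
    rw [real_inner_smul_left]; ring
  have hquad : ∑ k ∈ K, c k * (2 * ⟪y j - y k, d⟫ + ‖d‖ ^ 2) ^ 2 =
      4 * ∑ k ∈ K, c k * ⟪y j - y k, d⟫ ^ 2 + ‖d‖ ^ 2 * ⟪∑ k ∈ K, (4 * c k) • (y j - y k), d⟫ + ‖d‖ ^ 4 * ∑ k ∈ K, c k := by
    rw [sum_inner, Finset.mul_sum, Finset.mul_sum, Finset.mul_sum, ← Finset.sum_add_distrib, ← Finset.sum_add_distrib]
    refine Finset.sum_congr rfl fun k _ => ?_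
    rw [real_inner_smul_left]; ring
  -- the three norm / quadratic-form bounds
  have h1 : -(phiF * ‖d‖) ≤ ⟪∑ k ∈ K, (2 * dV k) • (y j - y k), d⟫ := by
    have := abs_real_inner_le_norm (∑ k ∈ K, (2 * dV k) • (y j - y k)) d
    have hle := mul_le_mul_of_nonneg_right hF hρ0
    have := neg_abs_le (⟪∑ k ∈ K, (2 * dV k) • (y j - y k), d⟫)
    linarith
  have h2 : -(beta * ‖d‖) ≤ ⟪∑ k ∈ K, (4 * c k) • (y j - y k), d⟫ := by
    have := abs_real_inner_le_norm (∑ k ∈ K, (4 * c k) • (y j - y k)) d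
    have hle := mul_le_mul_of_nonneg_right hB hρ0
    have := neg_abs_le (⟪∑ k ∈ K, (4 * c k) • (y j - y k), d⟫)
    linarith
  have h3 := hA d
  have h4 : C4 * ‖d‖ ^ 4 ≤ ‖d‖ ^ 4 * ∑ k ∈ K, c k := by
    rw [mul_comm]; exact mul_le_mul_of_nonneg_left hC4 (by positivity)
  have h5 := hfin ‖d‖ hρ0 hρs
  have h2' : -(beta * ‖d‖ ^ 3) ≤ ‖d‖ ^ 2 * ⟪∑ k ∈ K, (4 * c k) • (y j - y k), d⟫ := by
    have := mul_le_mul_of_nonneg_left h2 (sq_nonneg ‖d‖)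
    nlinarith
  rw [hlin, hquad] at hsum
  linarith

/-- ★ The CLOSED scalar condition: with `L := λ − β s + min(C₄, 0) s² > 0`, the quartic is `≥ −φ_F ρ + L ρ² ≥ −φ_F²/(4L)` on `[0, s]`, so
`φ_F² ≤ 4 L (ε + slack)` suffices for `hfin` (`β ≥ 0`). [folklore] -/
theorem quartic_ge_of_closed {ε σ s lam beta phiF C4 : ℝ} (hbeta : 0 ≤ beta)
    (hL : 0 < lam - beta * s + min C4 0 * s ^ 2) (hcert : phiF ^ 2 ≤ 4 * (lam - beta * s + min C4 0 * s ^ 2) * (ε + σ)) :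
    ∀ ρ : ℝ, 0 ≤ ρ → ρ ≤ s → -(ε + σ) ≤ -phiF * ρ + lam * ρ ^ 2 - beta * ρ ^ 3 + C4 * ρ ^ 4 := by
  intro ρ hρ0 hρs
  set L := lam - beta * s + min C4 0 * s ^ 2 with hLdef
  have hm0 : min C4 0 ≤ 0 := min_le_right _ _
  have hmC : min C4 0 ≤ C4 := min_le_left _ _
  have hρ2 : ρ ^ 2 ≤ s ^ 2 := pow_le_pow_left₀ hρ0 hρs 2
  -- the quartic dominates `−φ_F ρ + L ρ²`
  have hdom : -phiF * ρ + L * ρ ^ 2 ≤ -phiF * ρ + lam * ρ ^ 2 - beta * ρ ^ 3 + C4 * ρ ^ 4 := by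
    have e1 : beta * ρ ^ 3 ≤ beta * s * ρ ^ 2 := by
      have := mul_le_mul_of_nonneg_left hρs (mul_nonneg hbeta (sq_nonneg ρ))
      nlinarith
    have e2 : min C4 0 * s ^ 2 * ρ ^ 2 ≤ C4 * ρ ^ 4 := by
      have a1 : min C4 0 * s ^ 2 ≤ min C4 0 * ρ ^ 2 := mul_le_mul_of_nonpos_left hρ2 hm0
      have a2 : min C4 0 * ρ ^ 2 * ρ ^ 2 ≤ C4 * ρ ^ 2 * ρ ^ 2 :=
        mul_le_mul_of_nonneg_right (mul_le_mul_of_nonneg_right hmC (sq_nonneg ρ)) (sq_nonneg ρ)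
      have a3 := mul_le_mul_of_nonneg_right a1 (sq_nonneg ρ)
      nlinarith
    rw [hLdef]
    nlinarith
  -- and `−φ_F ρ + L ρ² ≥ −φ_F²/(4L) ≥ −(ε+σ)`
  have hsq : 0 ≤ L * (ρ - phiF / (2 * L)) ^ 2 := mul_nonneg hL.le (sq_nonneg _)
  have hexp : L * (ρ - phiF / (2 * L)) ^ 2 = -phiF * ρ + L * ρ ^ 2 + phiF ^ 2 / (4 * L) := by
    field_simp
    ring
  have hq : phiF ^ 2 / (4 * L) ≤ ε + σ := by
    rw [div_le_iff₀ (by positivity)]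
    linarith
  linarith

/-- ★ `not_moveUnstableCore_of_bregmanCert` with the closed scalar condition in place of `hfin`. [folklore] -/
theorem not_moveUnstableCore_of_bregmanCert_closed {ε Rm s : ℝ} {N : ℕ} {y : Fin N → EuclideanSpace ℝ (Fin 3)} {j : Fin N}
    (c Plo Phi : Fin N → ℝ) (lam beta phiF C4 : ℝ) (hbeta : 0 ≤ beta)
    (hrange : ∀ k ∈ (Finset.univ.erase j).filter (fun k => dist (y k) (y j) ≤ Rm), ∀ p : EuclideanSpace ℝ (Fin 3),
      dist p (y j) ≤ s → Plo k ≤ dist p (y k) ^ 2 ∧ dist p (y k) ^ 2 ≤ Phi k)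
    (hbreg : ∀ k ∈ (Finset.univ.erase j).filter (fun k => dist (y k) (y j) ≤ Rm), ∀ P : ℝ, Plo k ≤ P → P ≤ Phi k →
      c k * (P - dist (y j) (y k) ^ 2) ^ 2 ≤
        ((1 / 12) * P⁻¹ ^ 6 - (1 / 6) * P⁻¹ ^ 3) - ((1 / 12) * (dist (y j) (y k) ^ 2)⁻¹ ^ 6 - (1 / 6) * (dist (y j) (y k) ^ 2)⁻¹ ^ 3) -
          (-(1 / 2) * (dist (y j) (y k) ^ 2)⁻¹ ^ 7 + (1 / 2) * (dist (y j) (y k) ^ 2)⁻¹ ^ 4) * (P - dist (y j) (y k) ^ 2))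
    (hA : ∀ v : EuclideanSpace ℝ (Fin 3),
      lam * ‖v‖ ^ 2 ≤ (∑ k ∈ (Finset.univ.erase j).filter (fun k => dist (y k) (y j) ≤ Rm),
          (-(1 / 2) * (dist (y j) (y k) ^ 2)⁻¹ ^ 7 + (1 / 2) * (dist (y j) (y k) ^ 2)⁻¹ ^ 4)) * ‖v‖ ^ 2 +
        4 * ∑ k ∈ (Finset.univ.erase j).filter (fun k => dist (y k) (y j) ≤ Rm), c k * ⟪y j - y k, v⟫ ^ 2)
    (hB : ‖∑ k ∈ (Finset.univ.erase j).filter (fun k => dist (y k) (y j) ≤ Rm), (4 * c k) • (y j - y k)‖ ≤ beta)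
    (hF : ‖∑ k ∈ (Finset.univ.erase j).filter (fun k => dist (y k) (y j) ≤ Rm),
      (2 * (-(1 / 2) * (dist (y j) (y k) ^ 2)⁻¹ ^ 7 + (1 / 2) * (dist (y j) (y k) ^ 2)⁻¹ ^ 4)) • (y j - y k)‖ ≤ phiF)
    (hC4 : C4 ≤ ∑ k ∈ (Finset.univ.erase j).filter (fun k => dist (y k) (y j) ≤ Rm), c k)
    (hL : 0 < lam - beta * s + min C4 0 * s ^ 2)
    (hcert : phiF ^ 2 ≤ 4 * (lam - beta * s + min C4 0 * s ^ 2) *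
      (ε + s * (Rm / (Rm - s)) ^ 7 * (6000 / 343 * Rm⁻¹ ^ 4 + 2880 / 49 * Rm⁻¹ ^ 5 + 10 / 7 * Rm⁻¹ ^ 6 + 2 * Rm⁻¹ ^ 7))) :
    ¬ MoveUnstableCore ε Rm s N y j :=
  not_moveUnstableCore_of_bregmanCert c Plo Phi lam beta phiF C4 hrange hbreg hA hB hF hC4
    (quartic_ge_of_closed hbeta hL hcert)

/-! ## §3. Range bookkeeping and the assembled site certificate -/

/-- The squared length of a moved bond lies in `[(r_lo − s)², (r_hi + s)²]` when `r_lo ≤ dist y_j y_k ≤ r_hi`, `s ≤ r_lo` and `dist p y_j ≤ s`.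
[folklore] -/
theorem sq_dist_mem_range {s rlo rhi : ℝ} {p a b : EuclideanSpace ℝ (Fin 3)} (hlo : rlo ≤ dist a b) (hhi : dist a b ≤ rhi)
    (hs : s ≤ rlo) (hp : dist p a ≤ s) : (rlo - s) ^ 2 ≤ dist p b ^ 2 ∧ dist p b ^ 2 ≤ (rhi + s) ^ 2 := by
  have hs0 : 0 ≤ s := dist_nonneg.trans hp
  have t1 : dist a b ≤ dist p a + dist p b := by
    have := dist_triangle a p b; rw [dist_comm a p] at this; exact this
  have t2 : dist p b ≤ dist p a + dist a b := dist_triangle p a b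
  constructor
  · have h : rlo - s ≤ dist p b := by linarith
    exact pow_le_pow_left₀ (by linarith) h 2
  · have h : dist p b ≤ rhi + s := by linarith
    exact pow_le_pow_left₀ dist_nonneg h 2

/-- The `hrange` hypothesis of §2 from per-bond length enclosures `rlo k ≤ dist y_j y_k ≤ rhi k` with `s ≤ rlo k`, `Plo k ≤ (rlo k − s)²`,
`(rhi k + s)² ≤ Phi k`. [folklore] -/
theorem hrange_of_enclosures {Rm s : ℝ} {N : ℕ} {y : Fin N → EuclideanSpace ℝ (Fin 3)} {j : Fin N} (Plo Phi rlo rhi : Fin N → ℝ)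
    (henc : ∀ k ∈ (Finset.univ.erase j).filter (fun k => dist (y k) (y j) ≤ Rm),
      rlo k ≤ dist (y j) (y k) ∧ dist (y j) (y k) ≤ rhi k ∧ s ≤ rlo k ∧ Plo k ≤ (rlo k - s) ^ 2 ∧ (rhi k + s) ^ 2 ≤ Phi k) :
    ∀ k ∈ (Finset.univ.erase j).filter (fun k => dist (y k) (y j) ≤ Rm), ∀ p : EuclideanSpace ℝ (Fin 3),
      dist p (y j) ≤ s → Plo k ≤ dist p (y k) ^ 2 ∧ dist p (y k) ^ 2 ≤ Phi k := by
  intro k hk p hp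
  obtain ⟨h1, h2, h3, h4, h5⟩ := henc k hk
  have h := sq_dist_mem_range h1 h2 h3 hp
  exact ⟨h4.trans h.1, h.2.trans h5⟩

end Summit.AtomisticToContinuum.Crystallization.Theorems.FrustratedLawDichotomyCollarNonExempt

end
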